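import Literature.MathematicalPhysics.QuantumManyBody.PeriodicBoseGasFracEnergy
import Literature.MathematicalPhysics.QuantumManyBody.PeriodicKineticBudget

/-!
# Soft-mode Markov bookkeeping on the torus: infrared shell law + `O(ρaN)` energy ⇒ condensation

Topic `Literature/MathematicalPhysics/QuantumManyBody`, grouping namespace `BoseGas` (vocabulary of
`PeriodicBoseGas.lean` / `PeriodicBoseGasFracEnergy.lean`: `PeriodicTrialState`, `cellOccupation`,
`planeWaveMode`, `condensateOccupation`, `periodicEnergy`, `fracDispersion`). Elementary two-sector
bookkeeping (infrared law + kinetic Markov tail), the torus twin of the Dirichlet window/tail split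
of route BECInfraredBound and the state-level core of the strategy census of crux
`BECCovarianceTransport.SoftShellRelaxation` (stmt-AtomisticToContinuum-12684). Throughout
`|k_p| = 2π|p|/L = 2π√(∑ⱼpⱼ²)/L` is written out (it is the inlined `kn` of the BEC route files).

* `tsum_le_apply_add_indicator_add_markov` — abstract Markov shadow in `ℝ≥0∞`:
  `∑ n ≤ n(i₀) + ∑_{soft} n + (∑ w n)/K` whenever `w ≥ K` off `{i₀} ∪ soft`;
* `natCast_le_condensate_add_soft_add_kinetic` / `…_energy` — for a periodic trial state and
  `κ > 0`: `N ≤ ⟨Ψ,n₀Ψ⟩ + ∑_{0<|k_p|≤κ}⟨φ_p,γ_Ψφ_p⟩ + ⟨Ψ,TΨ⟩/κ²` (Parseval `∑_p⟨φ_p,γ_Ψφ_p⟩ = N`,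
  the gradient identity `∑_p|k_p|²⟨φ_p,γ_Ψφ_p⟩ = ⟨Ψ,TΨ⟩ ≤ ⟨Ψ,HΨ⟩`);
* `soft_le_of_shellLaw` — a dyadic shell law (every finite part of `B_j = {κ2⁻ʲ/2 < |k| ≤ κ2⁻ʲ}`
  carries `≤ A(κ2⁻ʲ)²`, `j ≥ 0`) bounds all soft modes `0 < |k| ≤ κ` by `(4/3)Aκ²` (the shells cover
  the soft set; geometric series);
* `condensate_ge_of_soft_le_of_energy_le`, `condensate_ge_of_shellLaw_of_energy_le` — numbers:
  soft `≤ B` (resp. shell law with constant `A`) and `⟨Ψ,HΨ⟩ ≤ eN` give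
  `⟨Ψ,n₀Ψ⟩ ≥ N - B - (e/κ²)N` (resp. `N - (4/3)Aκ² - (e/κ²)N`).

With `κ² = 8πρa` and `e ≈ 4πρa` the tail costs about `N/2`: a Bogoliubov-shaped infrared law
(`A = C L³c`, so `(4/3)Aκ² = (4/3)C·32π^{3/2}√(ρa³)N`) on a near-minimiser already gives `n₀ ≳ N/3`
with no separate ultraviolet input. The dilute energy input and the near-minimiser form are in
`PeriodicSoftModeMarkovDilute.lean`. Mathlib has the ingredients (`ENNReal.tsum_*`,
`exists_nat_pow_near`, `tsum_geometric_of_lt_one`); nothing here is specific to a source. [folklore]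
-/

noncomputable section

open MeasureTheory Filter Set
open scoped ENNReal NNReal BigOperators Topology

namespace Literature.MathematicalPhysics.QuantumManyBody.BoseGas

/-! ### Abstract Markov shadow -/

/-- **Markov shadow (abstract).** For `ℝ≥0∞`-valued families `n, w` on an index type, a
distinguished index `i₀`, a "soft" set and a level `K ≠ 0, ⊤` with `K ≤ w i` for every
`i ∉ {i₀} ∪ soft`: `∑ᵢ nᵢ ≤ n_{i₀} + ∑_{i ∈ soft} nᵢ + (∑ᵢ wᵢ nᵢ)/K`. [folklore] -/
theorem tsum_le_apply_add_indicator_add_markov {ι : Type*} [DecidableEq ι] (n w : ι → ℝ≥0∞)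
    (i₀ : ι) (soft : Set ι) [DecidablePred (· ∈ soft)] {K : ℝ≥0∞} (hK0 : K ≠ 0) (hKtop : K ≠ ⊤)
    (hhard : ∀ i, i ≠ i₀ → i ∉ soft → K ≤ w i) :
    ∑' i, n i ≤ n i₀ + ∑' i, soft.indicator n i + (∑' i, w i * n i) / K := by
  -- pointwise domination
  have hpt : ∀ i, n i ≤ (if i = i₀ then n i else 0) + soft.indicator n i + w i * n i / K := by
    intro i
    by_cases hi : i = i₀
    · subst hi
      simp only [if_true]
      exact le_self_add.trans le_self_add
    by_cases hs : i ∈ soft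
    · rw [Set.indicator_of_mem hs]
      exact (le_add_self).trans le_self_add
    · have hKw : K ≤ w i := hhard i hi hs
      have : n i ≤ w i * n i / K := by
        rw [ENNReal.le_div_iff_mul_le (Or.inl hK0) (Or.inl hKtop), mul_comm]
        exact mul_le_mul' hKw le_rfl
      exact this.trans le_add_self
  calc ∑' i, n i ≤ ∑' i, ((if i = i₀ then n i else 0) + soft.indicator n i + w i * n i / K) :=
        ENNReal.tsum_le_tsum hpt
    _ = ∑' i, (if i = i₀ then n i else 0) + ∑' i, soft.indicator n i + ∑' i, w i * n i / K := by
        rw [ENNReal.tsum_add, ENNReal.tsum_add]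
    _ = n i₀ + ∑' i, soft.indicator n i + (∑' i, w i * n i) / K := by
        congr 1
        · congr 1
          rw [tsum_ite_eq]
        · simp only [div_eq_mul_inv]
          rw [ENNReal.tsum_mul_right]

/-! ### The hard weight off the soft set -/

/-- Off the zero mode and the soft set `{p ≠ 0, |k_p| ≤ κ}` the kinetic weight is at least `κ²`:
`κ² ≤ |k_p|² = fracDispersion 2 L p`. [folklore] -/
theorem ofReal_sq_le_fracDispersion {L κ : ℝ} (hκ : 0 ≤ κ) {p : Fin 3 → ℤ} (hp : p ≠ 0)
    (hsoft : p ∉ {p : Fin 3 → ℤ | p ≠ 0 ∧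
      2 * Real.pi * Real.sqrt (∑ k : Fin 3, ((p k : ℤ) : ℝ) ^ 2) / L ≤ κ}) :
    ENNReal.ofReal (κ ^ 2) ≤ fracDispersion 2 L p := by
  set q : ℝ := 2 * Real.pi * Real.sqrt (∑ k : Fin 3, ((p k : ℤ) : ℝ) ^ 2) / L with hq
  have hlt : κ < q := by
    by_contra h
    exact hsoft ⟨hp, not_lt.mp h⟩
  rw [fracDispersion_two]
  refine ENNReal.ofReal_le_ofReal ?_
  have hsum : 0 ≤ ∑ k : Fin 3, ((p k : ℤ) : ℝ) ^ 2 := Finset.sum_nonneg fun k _ => sq_nonneg _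
  have hk : q ^ 2 = 4 * Real.pi ^ 2 * (∑ k : Fin 3, ((p k : ℤ) : ℝ) ^ 2) / L ^ 2 := by
    rw [hq, div_pow, mul_pow, mul_pow, Real.sq_sqrt hsum]
    ring
  calc κ ^ 2 ≤ q ^ 2 := pow_le_pow_left₀ hκ hlt.le 2
    _ = _ := hk

/-! ### The state-level shadow -/

/-- **Markov shadow for a periodic trial state.** For `Ψ ∈ PeriodicTrialState N L` and `κ > 0`:
`N ≤ ⟨Ψ, n₀Ψ⟩ + ∑_{0 < |k_p| ≤ κ} ⟨φ_p, γ_Ψ φ_p⟩ + ⟨Ψ, TΨ⟩/κ²`, where `⟨Ψ,TΨ⟩ = ∫_{Ω^N}|∇Ψ|²`.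
Parseval in the traced variable (`tsum_cellOccupation_planeWaveMode`), Parseval for the gradient
(`tsum_fracDispersion_two_mul_cellOccupation`) and the abstract Markov shadow. [folklore] -/
theorem natCast_le_condensate_add_soft_add_kinetic {N : ℕ} {L : ℝ} (hL : 0 < L)
    (Ψ : PeriodicTrialState N L) {κ : ℝ} (hκ : 0 < κ) :
    (N : ℝ≥0∞) ≤ condensateOccupation N L Ψ.ψ +
      ∑' p : Fin 3 → ℤ, {p : Fin 3 → ℤ | p ≠ 0 ∧
          2 * Real.pi * Real.sqrt (∑ k : Fin 3, ((p k : ℤ) : ℝ) ^ 2) / L ≤ κ}.indicator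
        (fun p => cellOccupation N L (planeWaveMode L p) Ψ.ψ) p +
      (∫⁻ X in cellN N L, kineticDensity Ψ.ψ X) / ENNReal.ofReal (κ ^ 2) := by
  classical
  have hK0 : ENNReal.ofReal (κ ^ 2) ≠ 0 := by
    rw [Ne, ENNReal.ofReal_eq_zero, not_le]; positivity
  have h := tsum_le_apply_add_indicator_add_markov
    (fun p => cellOccupation N L (planeWaveMode L p) Ψ.ψ) (fracDispersion 2 L) 0
    {p : Fin 3 → ℤ | p ≠ 0 ∧ 2 * Real.pi * Real.sqrt (∑ k : Fin 3, ((p k : ℤ) : ℝ) ^ 2) / L ≤ κ}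
    hK0 ENNReal.ofReal_ne_top (fun p hp hs => ofReal_sq_le_fracDispersion hκ.le hp hs)
  rw [Ψ.tsum_cellOccupation_planeWaveMode hL, tsum_fracDispersion_two_mul_cellOccupation hL Ψ,
    cellOccupation_planeWaveMode_zero] at h
  exact h

/-- **Markov shadow, energy form.** `N ≤ ⟨Ψ, n₀Ψ⟩ + (soft occupation) + ⟨Ψ, HΨ⟩/κ²` (`v ≥ 0`,
`lintegral_kineticDensity_le_periodicEnergy`). [folklore] -/
theorem natCast_le_condensate_add_soft_add_energy {N : ℕ} {L : ℝ} (hL : 0 < L) (v : ℝ → ℝ≥0∞)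
    (Ψ : PeriodicTrialState N L) {κ : ℝ} (hκ : 0 < κ) :
    (N : ℝ≥0∞) ≤ condensateOccupation N L Ψ.ψ +
      ∑' p : Fin 3 → ℤ, {p : Fin 3 → ℤ | p ≠ 0 ∧
          2 * Real.pi * Real.sqrt (∑ k : Fin 3, ((p k : ℤ) : ℝ) ^ 2) / L ≤ κ}.indicator
        (fun p => cellOccupation N L (planeWaveMode L p) Ψ.ψ) p +
      periodicEnergy v Ψ / ENNReal.ofReal (κ ^ 2) :=
  (natCast_le_condensate_add_soft_add_kinetic hL Ψ hκ).trans
    (add_le_add le_rfl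
      (ENNReal.div_le_div_right (lintegral_kineticDensity_le_periodicEnergy v Ψ) _))

/-- **Soft bound + energy ⇒ condensate, with numbers.** If the soft modes `0 < |k| ≤ κ` carry at
most `B` particles and the energy is at most `e·N`, then `⟨Ψ, n₀Ψ⟩ ≥ N - B - (e/κ²)·N`.
[folklore] -/
theorem condensate_ge_of_soft_le_of_energy_le {N : ℕ} {L : ℝ} (hL : 0 < L) (v : ℝ → ℝ≥0∞)
    (Ψ : PeriodicTrialState N L) {κ B e : ℝ} (hκ : 0 < κ) (hB : 0 ≤ B) (he : 0 ≤ e)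
    (hsoft : ∑' p : Fin 3 → ℤ, {p : Fin 3 → ℤ | p ≠ 0 ∧
          2 * Real.pi * Real.sqrt (∑ k : Fin 3, ((p k : ℤ) : ℝ) ^ 2) / L ≤ κ}.indicator
        (fun p => cellOccupation N L (planeWaveMode L p) Ψ.ψ) p ≤ ENNReal.ofReal B)
    (hE : periodicEnergy v Ψ ≤ ENNReal.ofReal (e * N)) :
    ENNReal.ofReal (N - B - e * N / κ ^ 2) ≤ condensateOccupation N L Ψ.ψ := by
  have hκ2 : 0 < κ ^ 2 := by positivity
  have hmain := natCast_le_condensate_add_soft_add_energy hL v Ψ hκ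
  have hdiv : periodicEnergy v Ψ / ENNReal.ofReal (κ ^ 2) ≤ ENNReal.ofReal (e * N / κ ^ 2) := by
    rw [ENNReal.ofReal_div_of_pos hκ2]
    exact ENNReal.div_le_div_right hE _
  have h1 : (N : ℝ≥0∞) ≤ condensateOccupation N L Ψ.ψ + ENNReal.ofReal (B + e * N / κ ^ 2) := by
    calc (N : ℝ≥0∞) ≤ condensateOccupation N L Ψ.ψ + ENNReal.ofReal B +
          ENNReal.ofReal (e * N / κ ^ 2) :=
            hmain.trans (add_le_add (add_le_add le_rfl hsoft) hdiv)
      _ = condensateOccupation N L Ψ.ψ + ENNReal.ofReal (B + e * N / κ ^ 2) := by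
            rw [add_assoc, ← ENNReal.ofReal_add hB (by positivity)]
  have hN : (N : ℝ≥0∞) = ENNReal.ofReal (N : ℝ) := (ENNReal.ofReal_natCast N).symm
  have hsub : ENNReal.ofReal (N - B - e * N / κ ^ 2) =
      ENNReal.ofReal (N : ℝ) - ENNReal.ofReal (B + e * N / κ ^ 2) := by
    rw [← ENNReal.ofReal_sub _ (by positivity)]
    congr 1
    ring
  rw [hsub, tsub_le_iff_right, ← hN]
  exact h1

/-! ### From a dyadic shell law to the soft bound -/

/-- A nonzero lattice momentum has positive modulus (for `L > 0`). [folklore] -/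
theorem waveNumber_pos_of_ne_zero {L : ℝ} (hL : 0 < L) {p : Fin 3 → ℤ} (hp : p ≠ 0) :
    0 < 2 * Real.pi * Real.sqrt (∑ k : Fin 3, ((p k : ℤ) : ℝ) ^ 2) / L := by
  have hsum : 0 < ∑ k : Fin 3, ((p k : ℤ) : ℝ) ^ 2 := by
    obtain ⟨k, hk⟩ : ∃ k, p k ≠ 0 := by
      by_contra h
      push Not at h
      exact hp (funext h)
    refine Finset.sum_pos' (fun i _ => sq_nonneg _) ⟨k, Finset.mem_univ _, ?_⟩
    have : ((p k : ℤ) : ℝ) ≠ 0 := by exact_mod_cast hk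
    positivity
  have : 0 < Real.sqrt (∑ k : Fin 3, ((p k : ℤ) : ℝ) ^ 2) := Real.sqrt_pos.mpr hsum
  positivity

/-- **The dyadic shells cover the soft set**: every `p` with `0 < |k_p| ≤ κ` lies in some shell
`B_j = {κ2⁻ʲ/2 < |k_p| ≤ κ2⁻ʲ}`, `j ≥ 0` (take `2ʲ ≤ κ/|k_p| < 2ʲ⁺¹`). [folklore] -/
theorem exists_mem_shell_of_soft {L κ : ℝ} (hL : 0 < L) {p : Fin 3 → ℤ} (hp0 : p ≠ 0)
    (hpk : 2 * Real.pi * Real.sqrt (∑ k : Fin 3, ((p k : ℤ) : ℝ) ^ 2) / L ≤ κ) :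
    ∃ j : ℕ, κ * 2⁻¹ ^ j / 2 < 2 * Real.pi * Real.sqrt (∑ k : Fin 3, ((p k : ℤ) : ℝ) ^ 2) / L ∧
      2 * Real.pi * Real.sqrt (∑ k : Fin 3, ((p k : ℤ) : ℝ) ^ 2) / L ≤ κ * 2⁻¹ ^ j := by
  set q : ℝ := 2 * Real.pi * Real.sqrt (∑ k : Fin 3, ((p k : ℤ) : ℝ) ^ 2) / L with hq
  have hkpos : 0 < q := waveNumber_pos_of_ne_zero hL hp0
  have hx : 1 ≤ κ / q := by rwa [le_div_iff₀ hkpos, one_mul]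
  obtain ⟨j, hj1, hj2⟩ := exists_nat_pow_near hx one_lt_two
  refine ⟨j, ?_, ?_⟩
  · have h2 : κ < 2 ^ (j + 1) * q := by rwa [div_lt_iff₀ hkpos] at hj2
    have hpow : (0 : ℝ) < 2 ^ j := by positivity
    rw [inv_pow, div_lt_iff₀ (by norm_num : (0:ℝ) < 2), mul_inv_lt_iff₀ hpow]
    calc κ < 2 ^ (j + 1) * q := h2
      _ = q * 2 * 2 ^ j := by ring
  · have h1 : 2 ^ j * q ≤ κ := by rwa [le_div_iff₀ hkpos] at hj1
    have hpow : (0 : ℝ) < 2 ^ j := by positivity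
    rw [inv_pow, ← div_eq_mul_inv, le_div_iff₀ hpow, mul_comm]
    exact h1

/-- **Shell law ⇒ soft bound.** If every finite subset of every dyadic shell `B_j` carries at most
`A·k_j²` particles (`k_j = κ2⁻ʲ`, `j ≥ 0`), then all soft modes `0 < |k| ≤ κ` together carry at most
`(4/3)·A·κ²`. [folklore] -/
theorem soft_le_of_shellLaw {N : ℕ} {L : ℝ} (hL : 0 < L) (Ψ : Config N → ℂ) {κ A : ℝ}
    (hκ : 0 < κ) (hA : 0 ≤ A)
    (hShell : ∀ j : ℕ, ∀ S : Finset (Fin 3 → ℤ),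
      (∀ n ∈ S, κ * 2⁻¹ ^ j / 2 < 2 * Real.pi * Real.sqrt (∑ k : Fin 3, ((n k : ℤ) : ℝ) ^ 2) / L ∧
        2 * Real.pi * Real.sqrt (∑ k : Fin 3, ((n k : ℤ) : ℝ) ^ 2) / L ≤ κ * 2⁻¹ ^ j) →
        ∑ n ∈ S, cellOccupation N L (planeWaveMode L n) Ψ ≤
          ENNReal.ofReal (A * (κ * 2⁻¹ ^ j) ^ 2)) :
    ∑' p : Fin 3 → ℤ, {p : Fin 3 → ℤ | p ≠ 0 ∧
          2 * Real.pi * Real.sqrt (∑ k : Fin 3, ((p k : ℤ) : ℝ) ^ 2) / L ≤ κ}.indicator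
        (fun p => cellOccupation N L (planeWaveMode L p) Ψ) p ≤
      ENNReal.ofReal (4 / 3 * A * κ ^ 2) := by
  classical
  set f : (Fin 3 → ℤ) → ℝ≥0∞ := fun p => cellOccupation N L (planeWaveMode L p) Ψ with hf
  set q : (Fin 3 → ℤ) → ℝ :=
    fun p => 2 * Real.pi * Real.sqrt (∑ k : Fin 3, ((p k : ℤ) : ℝ) ^ 2) / L with hq
  set soft : Set (Fin 3 → ℤ) := {p | p ≠ 0 ∧ q p ≤ κ} with hsoft_def
  set shell : ℕ → Set (Fin 3 → ℤ) :=
    fun j => {p | κ * 2⁻¹ ^ j / 2 < q p ∧ q p ≤ κ * 2⁻¹ ^ j} with hshell_def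
  show ∑' p, soft.indicator f p ≤ _
  -- pointwise: the soft indicator is dominated by the sum of the shell indicators
  have hpt : ∀ p, soft.indicator f p ≤ ∑' j : ℕ, (shell j).indicator f p := by
    intro p
    by_cases hp : p ∈ soft
    · obtain ⟨j, hj⟩ := exists_mem_shell_of_soft hL hp.1 hp.2
      have hjm : p ∈ shell j := hj
      rw [Set.indicator_of_mem hp]
      calc f p = (shell j).indicator f p := (Set.indicator_of_mem hjm f).symm
        _ ≤ ∑' j : ℕ, (shell j).indicator f p := ENNReal.le_tsum j
    · rw [Set.indicator_of_notMem hp]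
      exact bot_le
  -- each shell: tsum = sup over finite sets ≤ A k_j²
  have hshell : ∀ j : ℕ, ∑' p, (shell j).indicator f p ≤
      ENNReal.ofReal (A * (κ * 2⁻¹ ^ j) ^ 2) := by
    intro j
    rw [ENNReal.tsum_eq_iSup_sum]
    refine iSup_le fun s => ?_
    have hsum : ∑ p ∈ s, (shell j).indicator f p = ∑ p ∈ s.filter (· ∈ shell j), f p := by
      rw [Finset.sum_filter]
      refine Finset.sum_congr rfl fun p _ => ?_
      by_cases hp : p ∈ shell j
      · simp [hp]
      · simp [hp]
    rw [hsum]
    refine hShell j _ fun n hn => ?_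
    exact (Finset.mem_filter.mp hn).2
  -- sum the geometric series in ℝ
  have hgeo : ∑' j : ℕ, ENNReal.ofReal (A * (κ * 2⁻¹ ^ j) ^ 2) =
      ENNReal.ofReal (4 / 3 * A * κ ^ 2) := by
    have hterm : ∀ j : ℕ, A * (κ * 2⁻¹ ^ j) ^ 2 = A * κ ^ 2 * (4⁻¹ : ℝ) ^ j := by
      intro j
      rw [mul_pow, ← pow_mul, mul_comm j 2, pow_mul]
      norm_num
      ring
    simp_rw [hterm]
    have hq0 : (0 : ℝ) ≤ 4⁻¹ := by norm_num
    have hq1 : (4⁻¹ : ℝ) < 1 := by norm_num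
    have hsumm : Summable fun j : ℕ => A * κ ^ 2 * (4⁻¹ : ℝ) ^ j :=
      (summable_geometric_of_lt_one hq0 hq1).mul_left _
    rw [← ENNReal.ofReal_tsum_of_nonneg (fun j => by positivity) hsumm, tsum_mul_left,
      tsum_geometric_of_lt_one hq0 hq1]
    congr 1
    norm_num
    ring
  calc ∑' p, soft.indicator f p
        ≤ ∑' p, ∑' j : ℕ, (shell j).indicator f p := ENNReal.tsum_le_tsum hpt
    _ = ∑' j : ℕ, ∑' p, (shell j).indicator f p := ENNReal.tsum_comm
    _ ≤ ∑' j : ℕ, ENNReal.ofReal (A * (κ * 2⁻¹ ^ j) ^ 2) := ENNReal.tsum_le_tsum hshell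
    _ = ENNReal.ofReal (4 / 3 * A * κ ^ 2) := hgeo

/-- **Shell law + energy ⇒ condensate (one state).** For a periodic trial state `Ψ` on the torus of
side `L`: if every finite part of every dyadic shell `B_j` below `κ` carries at most `A k_j²`
particles and `⟨Ψ,HΨ⟩ ≤ e·N`, then `⟨Ψ, n₀Ψ⟩ ≥ N - (4/3)Aκ² - (e/κ²)N`. No variance, no
energy-excess decay and no separate ultraviolet law enter. [folklore] -/
theorem condensate_ge_of_shellLaw_of_energy_le {N : ℕ} {L : ℝ} (hL : 0 < L) (v : ℝ → ℝ≥0∞)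
    (Ψ : PeriodicTrialState N L) {κ A e : ℝ} (hκ : 0 < κ) (hA : 0 ≤ A) (he : 0 ≤ e)
    (hShell : ∀ j : ℕ, ∀ S : Finset (Fin 3 → ℤ),
      (∀ n ∈ S, κ * 2⁻¹ ^ j / 2 < 2 * Real.pi * Real.sqrt (∑ k : Fin 3, ((n k : ℤ) : ℝ) ^ 2) / L ∧
        2 * Real.pi * Real.sqrt (∑ k : Fin 3, ((n k : ℤ) : ℝ) ^ 2) / L ≤ κ * 2⁻¹ ^ j) →
        ∑ n ∈ S, cellOccupation N L (planeWaveMode L n) Ψ.ψ ≤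
          ENNReal.ofReal (A * (κ * 2⁻¹ ^ j) ^ 2))
    (hE : periodicEnergy v Ψ ≤ ENNReal.ofReal (e * N)) :
    ENNReal.ofReal (N - 4 / 3 * A * κ ^ 2 - e * N / κ ^ 2) ≤ condensateOccupation N L Ψ.ψ :=
  condensate_ge_of_soft_le_of_energy_le hL v Ψ hκ (by positivity) he
    (soft_le_of_shellLaw hL Ψ.ψ hκ hA hShell) hE

end Literature.MathematicalPhysics.QuantumManyBody.BoseGas
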